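import Summits.QuantumFields.GaugeBoot.Certificates.SparseReducedWindowP
import Summits.QuantumFields.GaugeBoot.Certificates.SparseReducedWindowBoundLe
import Summits.QuantumFields.GaugeBoot.Certificates.KZL2rpD4LIMTab
import Summits.QuantumFields.GaugeBoot.Certificates.KZL2rpLIMb2W22UpRow
import Summits.QuantumFields.GaugeBoot.Certificates.KZL2rpLIMb2W22UpG
import HarnessLib

/-!
# Kernel replay of the certsdp certificate `kzL2rpLIM_D4_b2_W2x2_upper` — part C: windows 14–14 (gb_lean_emit_win 0.11.0-lim)

HONEST FRAMING (cell `pub-gaugeboot`): certified bounds on lattice expectations at stated coupling,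
gauge group, dimension and torus size; NOT a mass gap, NOT a continuum limit, NOT a string tension;
NOT Yang–Mills-summit-bearing (barriers `FixedCouplingUltralocality`, `PerturbativeInvisibility`).

Problem (certsdp-problem/1 `kzL2_D4_b2_max_rp_hkhd_LIM_G2-W2x2-upper`, data sha256 `842221231dfca73ac07942ea1c4eef6a78deccc919aa5ad85a1fe636bb401f37`): 10878 variables (unit `y_0 = 1`,
`|y_v| ≤ 1`), 3300 equality rows and 9 INEQUALITY rows (class-LIMIT objects, multipliers κ ≥ 0) entering only through the aggregated row of `Certificates/KZL2rpLIMb2W22UpRow.lean`,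
75 symmetry-REDUCED PSD blocks of dimensions ≤ 48 (family `KZL2rpD4LIM`: `Certificates/KZL2rpD4LIMTabA.lean`), objective
`c·y` = (-1)·y_13 minimised.
Certificate (certsdp-conic/1, sha256 `f5d60853e5203e8cbc9910e76e2149f1df1570daed489c717683f822670a518c`): gram-mode duals `Z_k = G_k G_kᵀ/4^40` (factor rows `GB`:
`Certificates/KZL2rpLIMb2W22UpG.lean` + data parts) and exact multipliers; claimed lower bound `-7723555158418186720495793/16320498564797493858533376` (≈ -0.4732425990391).
EARLY-EXIT WINDOW ROUTE (`Certificates/SparseReducedWindowP.lean` on `SparseReducedWindow(Bound|E|H).lean`): the 10878 variables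
are split into 15 windows sized by predicted kernel seconds; for each window the kernel walks the SORTED entry tables (the family
table `EB`) against the factor rows — skip `v < lo` with one comparison, insert at the
shifted trie key `v − lo`, stop at the first `v ≥ hi`; sign-dispatch ℕ-accumulator dot products `dotPN` —, forms the integer residual numerators
`N_v = (c_v·D − n_v)·4^40 − t_v·D` and checks their signed/absolute sum against ONE emitted integer (`winCheckP` → `WinOK` via
`KZL2rpD4LIMTabS.sorted_chk`, `KZL2rpD4LIMTabA.row_len`); no trace/residual tables are stored.
ABSTRACT semidefinite statement only; the torus binding is lean1/lean2's step.
-/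

namespace Summit.QuantumFields.GaugeBoot.Certificates.KZL2rpLIMb2W22Up

noncomputable section

open Matrix Finset Literature.Computation.Certificates Summit.QuantumFields.GaugeBoot.Certificates.Sparse
  Summit.QuantumFields.GaugeBoot.Certificates.KZL2rpD4LIM Summit.QuantumFields.GaugeBoot.Certificates.KZL2rpLIMb2W22UpRow

/-! ## Window checks -/

set_option maxHeartbeats 0 in
/-- Kernel check, window 14: variables `9908 ≤ v < 10878` (24887 stored terms, trie depth 10, table offset 0; model 35.9 s = 24887 inserts + 30088 dot-product steps + 470019 term visits): early-exit sweep + residual sum. -/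
theorem w_14 : winCheckP KZL2rpLIMb2W22Up.GB EB 75 48 10 KZL2rpLIMb2W22Up.cZ RN ((4 : ℤ) ^ 40) ((RD : ℕ) : ℤ) 0 9908 10878 (43808723937699760947070468148428800) = true := by
  decide +kernel
/-- Windows 14–14: `WinOK` on `9908 ≤ v < 10878`. -/
theorem win_14_14 : WinOK KZL2rpLIMb2W22Up.GB EB 75 48 KZL2rpLIMb2W22Up.cZ RN ((4 : ℤ) ^ 40) ((RD : ℕ) : ℤ) 9908 10878 ((43808723937699760947070468148428800)) :=
  winOK_of_checkP0 sorted_chk row_len w_14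

end

end Summit.QuantumFields.GaugeBoot.Certificates.KZL2rpLIMb2W22Up
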